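import Summits.HodgeConjecture.HodgeConjecture.Theses.PadicSemiregularLift
import Summits.HodgeConjecture.HodgeConjecture.Theorems.FormalVectorBundlesAlgebraize.Negative.TowerTightness
import Summits.HodgeConjecture.HodgeConjecture.Theorems.PadicSemiregularLiftFormalVectorBundlesAlgebraizeTowerLadder
import Summits.HodgeConjecture.HodgeConjecture.Theorems.PadicSemiregularLiftFormalVectorBundlesAlgebraizeTowerRound
import Literature.AlgebraicGeometry.Resolution.ChowLemmaRing
import Literature.AlgebraicGeometry.Modules.VectorBundleFiniteLocallyFree
import Mathlib.CategoryTheory.Abelian.Basic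

/-!
# Tower presentation of a compatible system of vector bundles (stub EB1)

Stub `stub_towerPresentation` (EB1) of line `chow-zariski-pushforward` of the crux
`FormalVectorBundlesAlgebraize` (route `PadicSemiregularLift` of `HodgeConjecture`): on a `W(k)`-flat
`Z` whose level-one vector bundles satisfy Serre's (A)+(B) (`∃` a vector bundle `L ↠ ι_{1*}F` with
`Ȟ¹(𝒰, 𝓗om(L, ι_{1*}F)) = 0`), every compatible system `(F_n, s_n)` of vector bundles on the
`Z_{n+1}` is the cokernel of a compatible system of maps `u_n : V'|Z_{n+1} ⟶ V|Z_{n+1}` between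
restrictions of two vector bundles `V, V'` on `Z`.

Proof (Stacks 0D4B / EGA III₁ 5.1.4 §2.1, in the elementary form of the helper files
`…TowerLadder`, `…TowerLiftTools`, `…TowerRound`): Round 1 lifts `V ↠ ι_{1*}F_0` up the `p`-adic
ladders `0 → ι_{1*}F_0 → ι_{n+2,*}F_{n+1} → ι_{n+1,*}F_n → 0` (Čech lifting + nilpotent Nakayama) to
compatible epimorphisms `ṽ_n : V|Z_{n+1} ↠ F_n`; their kernels `K_n` form again a compatible system of
vector bundles, and Round 2 applied to it gives `w̃_n : V'|Z_{n+1} ↠ K_n`; `u_n = w̃_n ≫ (K_n ↪ V|Z_{n+1})`.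
-/

-- Summit.HodgeConjecture.HodgeConjecture.… repeats the summit name by the D-0017 layout (Sub = Summit).
set_option linter.dupNamespace false
-- `(𝟭 _).obj`, `(F ⋙ G).obj`, `TopCat.Presheaf` are not reducible (as in Mathlib's `AlgebraicGeometry/Modules`).
set_option backward.isDefEq.respectTransparency false

noncomputable section

open CategoryTheory CategoryTheory.Limits AlgebraicGeometry
open Literature.AlgebraicGeometry.Motives Literature.AlgebraicGeometry.Motives.WittScheme
open Literature.AlgebraicGeometry.Resolution
open Literature.AlgebraicGeometry.Morphisms (CechMH1)
open Literature.AlgebraicGeometry.Modules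
open Summit.HodgeConjecture.HodgeConjecture.Theorems.FormalVectorBundlesAlgebraize.Negative (thickeningMap_comp)
open Summit.HodgeConjecture.HodgeConjecture.Theorems.PadicPridhamSemiregularity (natCast_pow_eq_zero_thickening)

universe u

namespace Summit.HodgeConjecture.HodgeConjecture.Theorems.FormalVectorBundlesAlgebraize

/-! ### Two small abstract facts -/

/-- If the natural number `c` vanishes as a function on `Y`, it kills the sections of every direct
image `i_* F` of an `𝒪_Y`-module. -/
theorem nsmul_pushforward_sections_eq_zero {Y X : Scheme.{u}} (i : Y ⟶ X) (F : Y.Modules) (c : ℕ)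
    (hc : ∀ U : Y.Opens, ((c : ℕ) : Γ(Y, U)) = 0) (W : X.Opens)
    (y : Γ((Scheme.Modules.pushforward i).obj F, W)) : c • y = 0 := by
  change c • (show Γ(F, i ⁻¹ᵁ W) from y) = 0
  rw [← Nat.cast_smul_eq_nsmul Γ(Y, i ⁻¹ᵁ W), hc, zero_smul]

/-- The cokernel of `w ≫ (ker v ↪ E)` is the target of `v`, for epimorphisms `w` and `v`. -/
theorem nonempty_cokernel_iso_of_epi {C : Type*} [Category C] [Abelian C] {K' E F : C} (v : E ⟶ F)
    [Epi v] (w : K' ⟶ kernel v) [Epi w] : Nonempty (cokernel (w ≫ kernel.ι v) ≅ F) :=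
  ⟨cokernelEpiComp w (kernel.ι v) ≪≫ asIso (Abelian.factorThruCoimage v)⟩

/-! ### The `p`-adic tower -/

section Tower

variable {p : ℕ} [Fact p.Prime] {k : Type u} [Field k] [CharP k p] [PerfectRing k p]
  (Z : SchemeOver (WittVector p k))

omit [CharP k p] [PerfectRing k p] in
/-- The restrictions of a compatible system `(F_n, s_n)` to `Z_1` are all `F_0`:
`t'^* F_{n+1} ≅ F_0` for `t' : Z_1 ⟶ Z_{n+2}` (induction on `n`, `thickeningMap_comp`, `pullbackComp`). -/
theorem nonempty_pullback_iso_zero (hle : ∀ n : ℕ, n + 1 ≤ n + 1 + 1) (h1 : ∀ n : ℕ, 1 ≤ n + 1 + 1)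
    (F : ∀ n : ℕ, (thickening Z (n + 1)).left.Modules)
    (s : ∀ n, (Scheme.Modules.pullback (thickeningMap Z (hle n))).obj (F (n + 1)) ≅ F n) (n : ℕ) :
    Nonempty ((Scheme.Modules.pullback (thickeningMap Z (h1 n))).obj (F (n + 1)) ≅ F 0) := by
  induction n with
  | zero => exact ⟨s 0⟩
  | succ n ih =>
    obtain ⟨e⟩ := ih
    exact ⟨(Scheme.Modules.pullbackCongr (thickeningMap_comp Z (h1 n) (hle (n + 1))).symm).app _ ≪≫
      (Scheme.Modules.pullbackComp (thickeningMap Z (h1 n)) (thickeningMap Z (hle (n + 1)))).symm.app _ ≪≫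
      (Scheme.Modules.pullback (thickeningMap Z (h1 n))).mapIso (s (n + 1)) ≪≫ e⟩

variable [Flat Z.hom] {ι' : Type u} (U : ι' → Z.left.Opens)

/-- **One round** (`tower_lift` for the `p`-adic tower, its hypotheses supplied by `tower_ladder`):
for a compatible system `(F_n, s_n)` of finite locally free modules on the `Z_{n+1}` (`Z` flat over
`W(k)`), a finite locally free `V` on `Z` with `Ȟ¹(𝒰, 𝓗om(V, ι_{1*}F_0)) = 0` for a finite affine open
cover `𝒰`, and an epimorphism `V ↠ ι_{1*} F_0`, there are compatible epimorphisms `V|Z_{n+1} ↠ F_n`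
(`ht` is `thickeningMap_ι`, kept abstract). -/
theorem tower_round (hUaff : ∀ i, IsAffineOpen (U i)) (hUcov : ⨆ i, U i = ⊤)
    (hle : ∀ n : ℕ, n + 1 ≤ n + 1 + 1) (h1 : ∀ n : ℕ, 1 ≤ n + 1 + 1)
    (ht : ∀ n : ℕ, thickeningMap Z (hle n) ≫ thickeningι Z (n + 1 + 1) = thickeningι Z (n + 1))
    (F : ∀ n : ℕ, (thickening Z (n + 1)).left.Modules) (hF : ∀ n, IsFiniteLocallyFree (F n))
    (s : ∀ n, (Scheme.Modules.pullback (thickeningMap Z (hle n))).obj (F (n + 1)) ≅ F n)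
    {V : Z.left.Modules} (hV : IsFiniteLocallyFree V)
    (hH1 : Subsingleton (CechMH1 Z.hom
      (sheafHom V ((Scheme.Modules.pushforward (thickeningι Z (0 + 1))).obj (F 0))) U))
    (π : V ⟶ (Scheme.Modules.pushforward (thickeningι Z (0 + 1))).obj (F 0)) [Epi π] :
    ∃ v : ∀ n, (Scheme.Modules.pullback (thickeningι Z (n + 1))).obj V ⟶ F n, (∀ n, Epi (v n)) ∧
      ∀ n, (Scheme.Modules.pullback (thickeningMap Z (hle n))).map (v (n + 1)) ≫ (s n).hom =
        ((Scheme.Modules.pullbackComp (thickeningMap Z (hle n)) (thickeningι Z (n + 1 + 1))).app V ≪≫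
          (Scheme.Modules.pullbackCongr (ht n)).app V).hom ≫ v n := by
  haveI : ∀ n, IsClosedImmersion (thickeningι Z (n + 1)) := fun n => isClosedImmersion_thickeningι Z _
  /- Engineering note: the proof `ht` of `t_n ≫ ι_{n+2} = ι_{n+1}` is a *hypothesis* and all proof
  arguments of the abstract `tower_lift` are first bound as local hypotheses: otherwise the elaborator
  and the kernel compare un-reduced instances of its statement, which is very slow on the tower. -/
  -- the transition maps of the direct images (kept opaque: no `let` in this proof) and their ladders
  obtain ⟨g, hg⟩ : ∃ g : ∀ n, (Scheme.Modules.pushforward (thickeningι Z (n + 1 + 1))).obj (F (n + 1)) ⟶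
      (Scheme.Modules.pushforward (thickeningι Z (n + 1))).obj (F n),
      ∀ n, g n = (Scheme.Modules.pushforward (thickeningι Z (n + 1 + 1))).map
        ((Scheme.Modules.pullbackPushforwardAdjunction (thickeningMap Z (hle n))).unit.app (F (n + 1)) ≫
          (Scheme.Modules.pushforward (thickeningMap Z (hle n))).map (s n).hom) ≫
        (Scheme.Modules.pushforwardComp (thickeningMap Z (hle n)) (thickeningι Z (n + 1 + 1))).hom.app (F n) ≫
        (Scheme.Modules.pushforwardCongr (ht n)).hom.app (F n) :=
    ⟨_, fun n => rfl⟩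
  have hlad := fun n =>
    tower_ladder Z n (hle n) (h1 n) (F (n + 1)) (hF (n + 1)) (F n) (s n) (g n) ((hg n).trans rfl)
  have hloc := fun n => (hlad n).1
  -- `p^{2n+2}` kills `ι_{n+2,*} F_{n+1}`
  have hkill : ∀ (n : ℕ) (W : Z.left.Opens)
      (y : Γ((Scheme.Modules.pushforward (thickeningι Z (n + 1 + 1))).obj (F (n + 1)), W)),
      (p ^ (n + 1) * p ^ (n + 1)) • y = 0 := by
    intro n W y
    refine nsmul_pushforward_sections_eq_zero _ _ _ (fun U' => ?_) W y
    have hpp : p ^ (n + 1) * p ^ (n + 1) = p ^ (n + 1 + 1) * p ^ n := by ring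
    rw [hpp, Nat.cast_mul, natCast_pow_eq_zero_thickening Z (n + 1 + 1) U', zero_mul]
  -- the short exact sequences, with kernels `ι_{n+2,*} t'_* t'^* F_{n+1} ≅ ι_{1*} F_0`
  have hSES : ∀ n, ∃ (Q : Z.left.Modules)
      (j : Q ⟶ (Scheme.Modules.pushforward (thickeningι Z (n + 1 + 1))).obj (F (n + 1))) (w : j ≫ g n = 0),
      (ShortComplex.mk j (g n) w).ShortExact ∧
        Nonempty (Q ≅ (Scheme.Modules.pushforward (thickeningι Z (0 + 1))).obj (F 0)) := by
    intro n
    obtain ⟨j, w, hS⟩ := (hlad n).2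
    obtain ⟨e⟩ := nonempty_pullback_iso_zero Z hle h1 F s n
    exact ⟨_, j, w, hS, ⟨(Scheme.Modules.pushforwardComp (thickeningMap Z (h1 n))
      (thickeningι Z (n + 1 + 1))).app _ ≪≫
      (Scheme.Modules.pushforwardCongr (thickeningMap_ι Z (h1 n))).app _ ≪≫
      (Scheme.Modules.pushforward (thickeningι Z (0 + 1))).mapIso e⟩⟩
  -- `F_0` (locally free) is quasi-coherent, so `𝓗om(V, ι_{1*} F_0)` is affine-localizing
  have hG₀ : IsAffineLocalizing
      (sheafHom V ((Scheme.Modules.pushforward (thickeningι Z (0 + 1))).obj (F 0))) := by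
    haveI := ((hF 0).isVectorBundle).1
    exact isAffineLocalizing_sheafHom hV
      (isAffineLocalizing_pushforward (thickeningι Z (0 + 1)) (IsAffineLocalizing.of_isQuasicoherent (F 0)))
  -- (elaborated without expected type: unification must not unfold the tower morphisms)
  have key := tower_lift (X := Z.left) (A := WittVector p k) Z.hom U hUaff hUcov
    (fun n => (thickening Z (n + 1)).left) (fun n => thickeningι Z (n + 1)) (fun n => thickeningMap Z (hle n))
    ht F s g hg (fun n => p ^ (n + 1)) hloc hkill hSES hV hG₀ hH1 π
  exact key

omit [CharP k p] [PerfectRing k p] [Flat Z.hom] in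
/-- **The kernel tower of a round**: the kernels `K_n = ker ṽ_n` of compatible epimorphisms
`ṽ_n : V|Z_{n+1} ↠ F_n` onto finite locally free modules form a compatible system of finite locally
free modules, compatibly with the inclusions `K_n ↪ V|Z_{n+1}` (`exists_kernel_transition`). -/
theorem kernel_round (hle : ∀ n : ℕ, n + 1 ≤ n + 1 + 1)
    (ht : ∀ n : ℕ, thickeningMap Z (hle n) ≫ thickeningι Z (n + 1 + 1) = thickeningι Z (n + 1))
    (F : ∀ n : ℕ, (thickening Z (n + 1)).left.Modules) (hF : ∀ n, IsFiniteLocallyFree (F n))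
    (s : ∀ n, (Scheme.Modules.pullback (thickeningMap Z (hle n))).obj (F (n + 1)) ≅ F n)
    {V : Z.left.Modules} (hV : IsFiniteLocallyFree V)
    (v : ∀ n, (Scheme.Modules.pullback (thickeningι Z (n + 1))).obj V ⟶ F n) (hv : ∀ n, Epi (v n))
    (hC : ∀ n, (Scheme.Modules.pullback (thickeningMap Z (hle n))).map (v (n + 1)) ≫ (s n).hom =
        ((Scheme.Modules.pullbackComp (thickeningMap Z (hle n)) (thickeningι Z (n + 1 + 1))).app V ≪≫
          (Scheme.Modules.pullbackCongr (ht n)).app V).hom ≫ v n) :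
    (∀ n, IsFiniteLocallyFree (kernel (v n))) ∧
      ∃ κ : ∀ n, (Scheme.Modules.pullback (thickeningMap Z (hle n))).obj (kernel (v (n + 1))) ≅ kernel (v n),
        ∀ n, (κ n).hom ≫ kernel.ι (v n) =
          (Scheme.Modules.pullback (thickeningMap Z (hle n))).map (kernel.ι (v (n + 1))) ≫
            ((Scheme.Modules.pullbackComp (thickeningMap Z (hle n)) (thickeningι Z (n + 1 + 1))).app V ≪≫
              (Scheme.Modules.pullbackCongr (ht n)).app V).hom := by
  haveI := hv
  refine ⟨fun n => isFiniteLocallyFree_kernel_pullback (thickeningι Z (n + 1)) hV (hF n) (v n), ?_⟩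
  choose κ hκ using fun n => exists_kernel_transition (thickeningMap Z (hle n))
    ((Scheme.Modules.pullbackComp (thickeningMap Z (hle n)) (thickeningι Z (n + 1 + 1))).app V ≪≫
      (Scheme.Modules.pullbackCongr (ht n)).app V)
    (hF (n + 1)) (s n) (v (n + 1)) (v n) (hC n)
  exact ⟨κ, hκ⟩

end Tower

/-! ### The registered stub -/

section TowerIso
variable {p : ℕ} [Fact p.Prime] {k : Type} [CommRing k] (Z : SchemeOver (WittVector p k))
/-- The canonical identification `(M|Z_{n+2})|Z_{n+1} ≅ M|Z_{n+1}` along `Z_{n+1} ⟶ Z_{n+2} ⟶ Z =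
Z_{n+1} ⟶ Z` (Mathlib `pullbackComp`, `pullbackCongr`, tree `thickeningMap_ι`). -/
abbrev towerRestrictIso (n : ℕ) (M : Z.left.Modules) :
    (Scheme.Modules.pullback (thickeningMap Z (Nat.le_succ (n + 1)))).obj
        ((Scheme.Modules.pullback (thickeningι Z (n + 2))).obj M) ≅
      (Scheme.Modules.pullback (thickeningι Z (n + 1))).obj M :=
  (Scheme.Modules.pullbackComp (thickeningMap Z (Nat.le_succ (n + 1))) (thickeningι Z (n + 2))).app M ≪≫
    (Scheme.Modules.pullbackCongr (thickeningMap_ι Z (Nat.le_succ (n + 1)))).app M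
end TowerIso

/-- **EB1 — tower presentation** (Stacks 0D4B / EGA III₁ 5.1.4 §2.1 in elementary form; see the module
docstring). The hypothesis `ChowLemmaRing.IsProjOver Z` is not used. -/
theorem stub_towerPresentation :
    ∀ (p : ℕ) [Fact p.Prime] (k : Type) [Field k] [CharP k p] [PerfectRing k p]
      (Z : SchemeOver (WittVector p k)), ChowLemmaRing.IsProjOver Z → Flat Z.hom →
      ∀ (ι : Type) [Finite ι] (U : ι → Z.left.Opens), (∀ i, IsAffineOpen (U i)) → (⨆ i, U i) = ⊤ →
      (∀ (F : (thickening Z 1).left.Modules), IsVectorBundle F →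
          ∃ (L : Z.left.Modules), IsVectorBundle L ∧
            (∃ π : L ⟶ (Scheme.Modules.pushforward (thickeningι Z 1)).obj F, Epi π) ∧
            Subsingleton (CechMH1 Z.hom
              (sheafHom L ((Scheme.Modules.pushforward (thickeningι Z 1)).obj F)) U)) →
      ∀ (F : ∀ n : ℕ, (thickening Z (n + 1)).left.Modules), (∀ n, IsVectorBundle (F n)) →
        (∀ n, Nonempty ((Scheme.Modules.pullback (thickeningMap Z (Nat.le_succ (n + 1)))).obj
          (F (n + 1)) ≅ F n)) →
        ∃ (V V' : Z.left.Modules) (u : ∀ n : ℕ,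
            (Scheme.Modules.pullback (thickeningι Z (n + 1))).obj V' ⟶
              (Scheme.Modules.pullback (thickeningι Z (n + 1))).obj V),
          IsVectorBundle V ∧ IsVectorBundle V' ∧
          (∀ n, (Scheme.Modules.pullback (thickeningMap Z (Nat.le_succ (n + 1)))).map (u (n + 1)) =
            (towerRestrictIso Z n V').hom ≫ u n ≫ (towerRestrictIso Z n V).inv) ∧
          ∀ n, Nonempty (cokernel (u n) ≅ F n) := by
  intro p _ k _ _ _ Z _ hflat ι _ U hUaff hUcov hAB F hF hs
  haveI := hflat
  have hle : ∀ n : ℕ, n + 1 ≤ n + 1 + 1 := fun n => Nat.le_succ (n + 1)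
  have h1 : ∀ n : ℕ, 1 ≤ n + 1 + 1 := fun n => by omega
  have hFfl : ∀ n, IsFiniteLocallyFree (F n) := fun n => (hF n).isFiniteLocallyFree
  obtain ⟨s⟩ : Nonempty (∀ n, (Scheme.Modules.pullback (thickeningMap Z (hle n))).obj (F (n + 1)) ≅ F n) :=
    ⟨fun n => (hs n).some⟩
  have ht : ∀ n : ℕ, thickeningMap Z (hle n) ≫ thickeningι Z (n + 1 + 1) = thickeningι Z (n + 1) :=
    fun n => thickeningMap_ι Z (hle n)
  -- Round 1: `ṽ_n : V|Z_{n+1} ↠ F_n`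
  obtain ⟨V, hV, ⟨π, hπ⟩, hH1⟩ := hAB (F 0) (hF 0)
  obtain ⟨v, hv, hvC⟩ := tower_round Z U hUaff hUcov hle h1 ht F hFfl s hV.isFiniteLocallyFree hH1 π
  -- the kernel tower
  obtain ⟨hKfl, κ, hκ⟩ := kernel_round Z hle ht F hFfl s hV.isFiniteLocallyFree v hv hvC
  have hK : ∀ n, IsVectorBundle (kernel (v n)) := fun n => (hKfl n).isVectorBundle
  -- Round 2: `w̃_n : V'|Z_{n+1} ↠ K_n`
  obtain ⟨V', hV', ⟨π', hπ'⟩, hH1'⟩ := hAB (kernel (v 0)) (hK 0)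
  obtain ⟨w, hw, hwC⟩ := tower_round Z U hUaff hUcov hle h1 ht (fun n => kernel (v n)) hKfl κ
    hV'.isFiniteLocallyFree hH1' π'
  haveI := hv
  haveI := hw
  refine ⟨V, V', fun n => w n ≫ kernel.ι (v n), hV, hV', fun n => ?_, fun n =>
    nonempty_cokernel_iso_of_epi (v n) (w n)⟩
  -- compatibility (in the `ht`-form of the restriction isomorphisms, then converted to the statement's)
  have h₁ : (Scheme.Modules.pullback (thickeningMap Z (hle n))).map (w (n + 1)) =
      ((Scheme.Modules.pullbackComp (thickeningMap Z (hle n)) (thickeningι Z (n + 1 + 1))).app V' ≪≫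
        (Scheme.Modules.pullbackCongr (ht n)).app V').hom ≫ w n ≫ (κ n).inv := by
    rw [← Category.assoc, ← hwC n, Category.assoc, Iso.hom_inv_id, Category.comp_id]
  have h₂ : (Scheme.Modules.pullback (thickeningMap Z (hle n))).map (kernel.ι (v (n + 1))) =
      (κ n).hom ≫ kernel.ι (v n) ≫
        ((Scheme.Modules.pullbackComp (thickeningMap Z (hle n)) (thickeningι Z (n + 1 + 1))).app V ≪≫
          (Scheme.Modules.pullbackCongr (ht n)).app V).inv := by
    rw [← Category.assoc, hκ n, Category.assoc, Iso.hom_inv_id, Category.comp_id]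
  have h₃ : (Scheme.Modules.pullback (thickeningMap Z (hle n))).map (w (n + 1) ≫ kernel.ι (v (n + 1))) =
      ((Scheme.Modules.pullbackComp (thickeningMap Z (hle n)) (thickeningι Z (n + 1 + 1))).app V' ≪≫
        (Scheme.Modules.pullbackCongr (ht n)).app V').hom ≫ (w n ≫ kernel.ι (v n)) ≫
        ((Scheme.Modules.pullbackComp (thickeningMap Z (hle n)) (thickeningι Z (n + 1 + 1))).app V ≪≫
          (Scheme.Modules.pullbackCongr (ht n)).app V).inv := by
    rw [Functor.map_comp, h₁, h₂]
    simp only [Category.assoc, Iso.inv_hom_id_assoc]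
  -- the statement's restriction isomorphisms are these, by definition
  have eV : towerRestrictIso Z n V =
      (Scheme.Modules.pullbackComp (thickeningMap Z (hle n)) (thickeningι Z (n + 1 + 1))).app V ≪≫
        (Scheme.Modules.pullbackCongr (ht n)).app V := rfl
  have eV' : towerRestrictIso Z n V' =
      (Scheme.Modules.pullbackComp (thickeningMap Z (hle n)) (thickeningι Z (n + 1 + 1))).app V' ≪≫
        (Scheme.Modules.pullbackCongr (ht n)).app V' := rfl
  rw [eV, eV']
  exact h₃

end Summit.HodgeConjecture.HodgeConjecture.Theorems.FormalVectorBundlesAlgebraize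

end
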